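import Summits.BirchSwinnertonDyer.BirchSwinnertonDyer.Theorems.Rank2ObservatoryRank3CensusRanges
import HarnessLib

/-!
# BirchSwinnertonDyer — rank ≥ 2 observatory: the audited rank-3 census on the ANALYTIC side — `r_an = rank_ℤ = 3` with `hlow`, `hup` AND `w = −1` discharged by the kernel

HONEST FRAMING: per-curve certified theorems and census instruments; no claim on BSD in rank ≥ 2.

The census theorem `Rank3CensusAudit.analyticRank_eq_three_of_mem_rank3Table` (`Rank2ObservatoryRank3CensusResidual`)
concludes `r_an(E) = rank_ℤ E(ℚ) = 3` for every row of the rank-3 table from Gross–Zagier–Kolyvagin `hGZK`, the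
2-descent bound `rank_ℤ ≤ 3` for the 122 residual rows only, the numerical input `L‴(E,1) ≠ 0`, and the sign
`hw : w(E) = −1`.  The cell's ROOT-NUMBER CENSUS (`Rank2ObservatoryRank3RootNumberCensus` / `…RootNumber3Census`:
one kernel-checked certificate `RNCert` / `RNCert3` per row; `Rank3Row.rootNumber_eq_neg_one_of_mem`) computes
`w(E) = −1` for EVERY row modulo the tree's NAMED local-root-number facts `hKD`
(`rootNumber_eq_neg_finprod_tableLocalRootNumberAt'`: Kellock–Dokchitser's corrected `ℚ₂` table + Rohrlich, guarded
at `3`) and `hR` (`rootNumber_eq_neg_finprod_fullTableLocalRootNumberAt`: the same completed by Rizzo's Table II at `3`).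
This file performs the join, so that the ONLY remaining inputs are published theorems used as named hypotheses
(`hGZK`, `hKD`, `hR`), the engine-side numerical certificate `L‴(E,1) ≠ 0` per row, and — for the 122 residual rows
only — `rank_ℤ ≤ 3`:
* `Rank3CensusAudit.analyticRank_eq_three_of_mem_rank3Table_w` (whole table), `…_of_not_mem_residualRows_w`
  (the 9 365 audited rows: no rank hypothesis at all), `…_of_N_lt_w` (every table curve with `N < 61 504`),
  `Rank3KernelRankCensusN9365.analyticRank_eq_three_w` (over the GRAND census rows);
* `exists_distinct_curves_analyticRank_three` : granting `hGZK`, `hKD`, `hR` and the numerical input for the table,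
  there are 9 365 pairwise DISTINCT elliptic curves with `N_E < 5·10⁵`, `r_an(E) = 3` and `rank_ℤ E(ℚ) = 3`.
Each conclusion `r_an(E) = rank_ℤ E(ℚ)` is a PER-CURVE conditional theorem (conditional on the inputs just
listed); nothing is claimed about curves outside the table or about BSD in rank ≥ 2 in general.  Sorry-free; no new
axioms; no new kernel computation (term-level joins of landed theorems).
References: B. H. Gross, *Kolyvagin's work on modular elliptic curves* (LMS LN 153, 1991) (1.1), Thm. 1.3; H. Darmon,
*Rational Points on Modular Elliptic Curves* (CBMS 101, 2004) Thm. 3.22; O. Rizzo, *Average root numbers for a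
nonconstant family of elliptic curves*, Compositio Math. 136 (2003) §1 Fact 3, Table II; Kellock–Dokchitser, *Root
numbers and parity phenomena*, Bull. LMS 55 (2023) Thm. 2.3, §5; J. E. Cremona, *Algorithms for Modular Elliptic Curves*
(2nd ed. 1997) §2.13, Tables.
-/

-- single-conjunct summit: `Summit.BirchSwinnertonDyer.BirchSwinnertonDyer.…` repeats the name by design
set_option linter.dupNamespace false
set_option autoImplicit false

namespace Summit.BirchSwinnertonDyer.BirchSwinnertonDyer.Rank2Observatory

open Literature Literature.NumberTheory.EllipticCurves WeierstrassCurve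
open Rank3CensusAudit

/-- **`r_an(E) = rank_ℤ E(ℚ) = 3` over the WHOLE rank-3 table with `hlow`, `hup` (outside the 122 residual rows) and
`w(E) = −1` discharged by the kernel**: remaining inputs `hGZK`, the named local-root-number facts `hKD`, `hR`, the
numerical `L‴(E,1) ≠ 0`, and `rank_ℤ ≤ 3` for the residual rows only. [cite: Darmon2004, Thm. 3.22]
[cite: Rizzo2003, §1 Fact 3 and Table II (p. 4)] [cite: KellockDokchitser2023, Thm. 2.3 and §5] -/
theorem Rank3CensusAudit.analyticRank_eq_three_of_mem_rank3Table_w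
    (hGZK : rank_eq_analyticRank_of_analyticRank_le_one) {r : Rank3Row} (hr : r ∈ rank3Table)
    (hup : r ∈ residualRows → r.curve.mordellWeilRank ≤ 3)
    (hL3 : iteratedDeriv 3 r.curve.entireLFunction 1 ≠ 0)
    (hKD : r.curve.rootNumber_eq_neg_finprod_tableLocalRootNumberAt')
    (hR : r.curve.rootNumber_eq_neg_finprod_fullTableLocalRootNumberAt) :
    r.curve.analyticRank = r.curve.mordellWeilRank ∧ r.curve.analyticRank = 3 :=
  analyticRank_eq_three_of_mem_rank3Table hGZK hr hup hL3 (Rank3Row.rootNumber_eq_neg_one_of_mem hr hKD hR)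

/-- **The 9 365 audited rows: `r_an(E) = rank_ℤ E(ℚ) = 3` with NO rank hypothesis and NO sign hypothesis** — only
`hGZK`, `hKD`, `hR` (published theorems, named) and the numerical `L‴(E,1) ≠ 0`. [cite: Darmon2004, Thm. 3.22]
[cite: Cassels1991LecturesEllipticCurves, §15] [cite: Rizzo2003, §1 Fact 3 and Table II (p. 4)] -/
theorem Rank3CensusAudit.analyticRank_eq_three_of_not_mem_residualRows_w
    (hGZK : rank_eq_analyticRank_of_analyticRank_le_one) {r : Rank3Row} (hr : r ∈ rank3Table)
    (hn : r ∉ residualRows) (hL3 : iteratedDeriv 3 r.curve.entireLFunction 1 ≠ 0)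
    (hKD : r.curve.rootNumber_eq_neg_finprod_tableLocalRootNumberAt')
    (hR : r.curve.rootNumber_eq_neg_finprod_fullTableLocalRootNumberAt) :
    r.curve.analyticRank = r.curve.mordellWeilRank ∧ r.curve.analyticRank = 3 :=
  Rank3CensusAudit.analyticRank_eq_three_of_mem_rank3Table_w hGZK hr (fun h => absurd h hn) hL3 hKD hR

/-- The same for every table curve of conductor `N < 61 504` (all 189 of them lie outside the residual list,
`Rank2ObservatoryRank3CensusRanges`). [cite: Darmon2004, Thm. 3.22] [cite: CremonaAlgorithms1997, §2.13 and Tables] -/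
theorem Rank3CensusAudit.analyticRank_eq_three_of_N_lt_w
    (hGZK : rank_eq_analyticRank_of_analyticRank_le_one) {r : Rank3Row} (hr : r ∈ rank3Table)
    (hN : r.N < 61504) (hL3 : iteratedDeriv 3 r.curve.entireLFunction 1 ≠ 0)
    (hKD : r.curve.rootNumber_eq_neg_finprod_tableLocalRootNumberAt')
    (hR : r.curve.rootNumber_eq_neg_finprod_fullTableLocalRootNumberAt) :
    r.curve.analyticRank = r.curve.mordellWeilRank ∧ r.curve.analyticRank = 3 :=
  Rank3CensusAudit.analyticRank_eq_three_of_not_mem_residualRows_w hGZK hr (not_mem_residualRows_of_N_lt hN)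
    hL3 hKD hR

/-- **GRAND-census form**: over the 9 365 rows of `Rank3KernelRankCensusN9365`, `r_an(E) = rank_ℤ E(ℚ) = 3` from
`hGZK`, `hKD`, `hR` and the numerical `L‴(E,1) ≠ 0` alone (upgrade of `Rank3KernelRankCensusN9365.analyticRank_eq_three`,
whose `w(E) = −1` input is now the kernel's). [cite: Darmon2004, Thm. 3.22] [cite: KellockDokchitser2023, Thm. 2.3 and §5] -/
theorem Rank3KernelRankCensusN9365.analyticRank_eq_three_w (hGZK : rank_eq_analyticRank_of_analyticRank_le_one) :
    ∀ r ∈ Rank3KernelRankCensusN9365.rows, iteratedDeriv 3 r.curve.entireLFunction 1 ≠ 0 →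
      r.curve.rootNumber_eq_neg_finprod_tableLocalRootNumberAt' →
      r.curve.rootNumber_eq_neg_finprod_fullTableLocalRootNumberAt →
      r.curve.analyticRank = r.curve.mordellWeilRank ∧ r.curve.analyticRank = 3 :=
  fun _ hr hL3 hKD hR =>
    Rank3CensusAudit.analyticRank_eq_three_of_not_mem_residualRows_w hGZK ((mem_rows_iff).1 hr).1
      ((mem_rows_iff).1 hr).2 hL3 hKD hR

/-- **HEADLINE (analytic side).** Granting Gross–Zagier–Kolyvagin, the named local-root-number facts for the curves of
the table, and the engine-side numerical input `L‴(E,1) ≠ 0` for the rows of the table, there are 9 365 pairwise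
DISTINCT elliptic curves over `ℚ` of conductor `< 5·10⁵` with `r_an(E) = 3` AND `rank_ℤ E(ℚ) = 3` — the rank being a
hypothesis-free kernel theorem, the analytic rank a per-curve conditional one. [cite: Darmon2004, Thm. 3.22]
[cite: Cassels1991LecturesEllipticCurves, §15] [cite: CremonaAlgorithms1997, §2.13 and Tables] -/
theorem exists_distinct_curves_analyticRank_three (hGZK : rank_eq_analyticRank_of_analyticRank_le_one)
    (hKD : ∀ r ∈ rank3Table, r.curve.rootNumber_eq_neg_finprod_tableLocalRootNumberAt')
    (hR : ∀ r ∈ rank3Table, r.curve.rootNumber_eq_neg_finprod_fullTableLocalRootNumberAt)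
    (hL3 : ∀ r ∈ rank3Table, iteratedDeriv 3 r.curve.entireLFunction 1 ≠ 0) :
    ∃ l : List (WeierstrassCurve ℚ), l.Nodup ∧ l.length = 9365 ∧
      ∀ E ∈ l, E.IsElliptic ∧ E.conductorNorm ℤ < 500000 ∧ E.analyticRank = 3 ∧ E.mordellWeilRank = 3 := by
  refine ⟨Rank3KernelRankCensusN9365.rows.map Rank3Row.curve, rows_curves_nodup,
    by rw [List.length_map, Rank3KernelRankCensusN9365.rows_length], ?_⟩
  intro E hE
  obtain ⟨r, hr, rfl⟩ := List.mem_map.1 hE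
  have ht : r ∈ rank3Table := ((mem_rows_iff).1 hr).1
  have h := Rank3KernelRankCensusN9365.analyticRank_eq_three_w hGZK r hr (hL3 r ht) (hKD r ht) (hR r ht)
  exact ⟨isElliptic_of_mem ht, Rank3Row.conductorNorm_lt_of_mem ht, h.2, h.1.symm.trans h.2⟩

/-- Row `0` (`5077a1`): `r_an = rank_ℤ = 3` from `hGZK`, `hKD`, `hR` and `L‴(E,1) ≠ 0` alone (no rank and no sign
hypothesis). [cite: Darmon2004, Thm. 3.22] [cite: CremonaAlgorithms1997, Tables] -/
theorem analyticRank_5077a1_w (hGZK : rank_eq_analyticRank_of_analyticRank_le_one)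
    (hL3 : iteratedDeriv 3 (rank3Table[0]'(by rw [rank3Table_length]; decide)).curve.entireLFunction 1 ≠ 0)
    (hKD : (rank3Table[0]'(by rw [rank3Table_length]; decide)).curve.rootNumber_eq_neg_finprod_tableLocalRootNumberAt')
    (hR : (rank3Table[0]'(by rw [rank3Table_length]; decide)).curve.rootNumber_eq_neg_finprod_fullTableLocalRootNumberAt) :
    (rank3Table[0]'(by rw [rank3Table_length]; decide)).curve.analyticRank = 3 ∧
      (rank3Table[0]'(by rw [rank3Table_length]; decide)).curve.mordellWeilRank = 3 := by
  have h := Rank3CensusAudit.analyticRank_eq_three_of_N_lt_w hGZK (List.getElem_mem _)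
    (by decide +kernel) hL3 hKD hR
  exact ⟨h.2, h.1.symm.trans h.2⟩

end Summit.BirchSwinnertonDyer.BirchSwinnertonDyer.Rank2Observatory
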